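import Summits.QuantumFields.BalabanUV.T4Continuum.Support.ShellMeasureLocalGradientTailJet
import Summits.QuantumFields.BalabanUV.T4Continuum.Support.ShellMeasurePlaquetteTwist

/-!
# `T4Continuum.ShellMeasurePlaquetteCubicSlice` — the complex SLICE `t ↦ plaqFunSym (t • A)` of the symmetrised plaquette
# functional: its explicit cubic Taylor polynomial, the fourth-order remainder `‖τ‖·ρ₄(|t|·S)`, and
# `ord₃ (plaqFunSym) A = a₃ + (quartic tail)` (file 4 of 5 of «S65 f4»: [Balaban1985Variational] (33)∕(36) TYPE at one grid)

Cell `pub-balaban`, sub-cell `t4`, spine estimate NE7c (node U5b), NE7c ROUND-2 crew `t4-ne7c-formalise-*`, unit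
`b2b-balaban-t4-ne7c-formalise-leaf-03` gen 4; owner table `t4/b2b-balaban-t4-ne7c-p1/LEAVES-NE7c-P1.md` v2.9 row **S65 f4**
(owner GO journal l.15517, row holder leaf-02-g8 GO l.15529).  ADDITIVE: imports the owner's S62 f3
`ShellMeasureLocalGradientTailJet` (`ord₃`; `B13ExpansionOrder`∕`B11SchwarzRemainder` through it) and file 3
`ShellMeasurePlaquetteTwist` (hence file 1 `ShellMeasureCubicTaylor` and S62 f2); modifies nothing; [folklore]; 0
`def … : Prop`, 0 sorry, 0 citation tags.

HONEST FRAMING.  Finite four-torus programme, rung (B)+1 only — NOT infinite volume, NOT a mass gap, NOT the Clay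
problem, NOT summit progress.  NE7c (`T4IndicatorShell.ShellWeightBound`) is NOT PRINTED and NOT PROVED; «NE7c ⇐ the
named binders».  Nothing of [Balaban1985Variational] is asserted: p. 283 (34) (the twisted variables «A′(b) for bonds
b ⊂ ∂p»), p. 284 (39) «V₀(A, ∂p) = ¼ i tr(DA)(p)·Σ_{b₁<b₂} i[A′(b₁), A′(b₂)] + V₀′(A, ∂p)» and (40), with (33) (the quartic
tail) and (38) (the hidden small factor `Re U₀(∂p) − 1`), are LOCATORS for the SHAPE reproduced at ONE GRID (`Lʲη = η`, sup
norms, no `η`-weights — the printed currency is row S63 (a)'s and S65 f2a's bookkeeping).  HONEST DEPENDENCY (cell,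
verbatim): continuum YM on T⁴ ⇐ BetaPertH ∧ nine spine estimates (0/9 proved); BetaPertH ⇐ (D1) ∧ (D4) ∧ CAP+tail; G-an2-4
gates asym, D1 and NE2/3/4.

WHAT IS PROVED (for `τ : 𝔸 →L[ℂ] ℂ`, `U : Λ → 𝔸ˣ`, `bd : Fin 4 → Λ × Bool`, `A : Λ → 𝔸`; `tw` = the four twisted variables,
`twR` = reversed negated, `amp = S = Σ‖yᵢ‖`):
* §3 `coef`, `a₁ a₂ a₃`, `cubicPoly` (`a₀ + a₁t + a₂t² + a₃t³`, `aₖ = −½(τ(Pₖ·U₀(∂p)) + τ(U₀(∂p)⁻¹·P̄ₖ))` with `Pₖ` the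
  word polynomials of file 1) and THE ALGEBRAIC IDENTITY `slice_sub_cubicPoly`: `plaqFunSym(t•A) − cubicPoly t` = the two
  fourth-order word remainders paired with the background word;
* §3b **`norm_slice_sub_cubicPoly_le`**: `‖plaqFunSym(t•A) − cubicPoly t‖ ≤ ‖τ‖·ρ₄(‖t‖·S)` for a unit-bounded background
  (file 1's `T3` data of both words); `amp_le`: `S ≤ Σᵢ‖A(bᵢ)‖ ≤ 4σ`;
* §4 `hasDerivAt_cubicPoly`, the remainder `h = slice − cubicPoly` is entire and `O(t⁴)` (`orderGe_four_sliceRem`), hence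
  `h′(0) = h″(0) = 0` (`B11SchwarzRemainder.tail_vanish_and_bound` + `B13ExpansionOrder.factorial_smul_leadCoeff`), hence
  `g′(0) = a₁`, `g″(0) = 2a₂` for the slice `g` (`deriv_slice_plaqFunSym`), hence — through S62 f3's `ord₃_apply` and
  `B13ExpansionOrder.deriv_slice_zero`∕`deriv_deriv_slice_zero` — **`ord₃_plaqFunSym_eq`**:
  `ord₃ (plaqFunSym τ U bd) A = a₃ + (plaqFunSym A − cubicPoly 1)`.
File 5 `ShellMeasurePlaquetteCubicSplit` splits `a₃` by the cubic word algebra of file 2 and bounds the pieces.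
-/

noncomputable section

open scoped BigOperators
open NormedSpace Metric Set

namespace Summit.QuantumFields.BalabanUV.T4Continuum.ShellMeasurePlaquetteCubicSlice

open Literature.MathematicalPhysics.QuantumFieldTheory.Balaban1983to89
open B7Prop1Explicit (U1 mem_U1)
open ShellMeasureWilsonGradientTail (letter plaqWord plaqFun expWord_plaqWord analyticAt_plaqFun)
open ShellMeasureCubicTaylor (expRem4 expRem4_le expRem4_mono expRem4_nonneg T3 expProd expProd_nil expProd_cons polyL polyQ
  polyC polyL_smul polyQ_smul polyC_smul t3_expProd_of_le sum_norm_smul)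
open B11SchwarzRemainder (OrderGe tail leadCoeff tail_vanish_and_bound)
open B13ExpansionOrder (slice slice_apply deriv_slice_zero deriv_deriv_slice_zero factorial_smul_leadCoeff)
open ShellMeasureLocalGradientTailJet (ord₃ ord₃_apply)
open ShellMeasureAverageAnalytic (ExpWord)
open ShellMeasurePlaquetteTwist (wordU twistVar twists twists_nil twists_cons plaqWord_eq_wordU val_wordU_eq val_inv_wordU_eq
  twists_smul reverse_map_neg_smul sum_norm_reverse_neg sum_norm_twists_le plaqFunSym analyticAt_plaqFunSym
  analyticOnNhd_plaqFunSym letter_zero)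

variable {Λ : Type*} {𝔸 : Type*} [NormedRing 𝔸] [NormedAlgebra ℂ 𝔸] [CompleteSpace 𝔸]

/-! ## §3 The slice expansion: `t ↦ plaqFunSym (t • A)` is an explicit cubic polynomial up to `‖τ‖·ρ₄(|t|·S)` -/

section Slice

/-- The four twisted variables of the plaquette word (print's `A′(b)`, `b ⊂ ∂p`, times `±I`). [folklore] -/
def tw (U : Λ → 𝔸ˣ) (bd : Fin 4 → Λ × Bool) (A : Λ → 𝔸) : List 𝔸 := twists U 1 (List.ofFn bd) A

/-- … and those of the inverse word: reversed and negated. [folklore] -/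
def twR (U : Λ → 𝔸ˣ) (bd : Fin 4 → Λ × Bool) (A : Λ → 𝔸) : List 𝔸 := (tw U bd A).reverse.map Neg.neg

/-- THE AMPLITUDE `S = Σᵢ ‖yᵢ‖` of the twisted word. [folklore] -/
def amp (U : Λ → 𝔸ˣ) (bd : Fin 4 → Λ × Bool) (A : Λ → 𝔸) : ℝ := ((tw U bd A).map (‖·‖)).sum

/-- The Taylor coefficient attached to a pair of word polynomials `(P, P̄)`:
`−½(τ(P · U(∂p)) + τ(U(∂p)⁻¹ · P̄))`. [folklore] -/
def coef (τ : 𝔸 →L[ℂ] ℂ) (U : Λ → 𝔸ˣ) (bd : Fin 4 → Λ × Bool) (P Pr : 𝔸) : ℂ :=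
  -((2 : ℂ)⁻¹ * (τ (P * (plaqWord U bd 0 : 𝔸)) + τ ((((plaqWord U bd 0)⁻¹ : 𝔸ˣ) : 𝔸) * Pr)))

/-- The linear, quadratic, cubic Taylor coefficients of the slice. [folklore] -/
def a₁ (τ : 𝔸 →L[ℂ] ℂ) (U : Λ → 𝔸ˣ) (bd : Fin 4 → Λ × Bool) (A : Λ → 𝔸) : ℂ :=
  coef τ U bd (polyL (tw U bd A)) (polyL (twR U bd A))

/-- [folklore] -/
def a₂ (τ : 𝔸 →L[ℂ] ℂ) (U : Λ → 𝔸ˣ) (bd : Fin 4 → Λ × Bool) (A : Λ → 𝔸) : ℂ :=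
  coef τ U bd (polyQ (tw U bd A)) (polyQ (twR U bd A))

/-- [folklore] -/
def a₃ (τ : 𝔸 →L[ℂ] ℂ) (U : Λ → 𝔸ˣ) (bd : Fin 4 → Λ × Bool) (A : Λ → 𝔸) : ℂ :=
  coef τ U bd (polyC (tw U bd A)) (polyC (twR U bd A))

/-- THE CUBIC TAYLOR POLYNOMIAL of the slice `t ↦ plaqFunSym (t • A)`. [folklore] -/
def cubicPoly (τ : 𝔸 →L[ℂ] ℂ) (U : Λ → 𝔸ˣ) (bd : Fin 4 → Λ × Bool) (A : Λ → 𝔸) (t : ℂ) : ℂ :=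
  plaqFunSym τ U bd 0 + t * a₁ τ U bd A + t ^ 2 * a₂ τ U bd A + t ^ 3 * a₃ τ U bd A

/-- The word at the scaled field, twisted. [folklore] -/
theorem val_plaqWord_smul (U : Λ → 𝔸ˣ) (bd : Fin 4 → Λ × Bool) (A : Λ → 𝔸) (t : ℂ) :
    (plaqWord U bd (t • A) : 𝔸) = expProd ((tw U bd A).map (t • ·)) * (plaqWord U bd 0 : 𝔸) := by
  rw [plaqWord_eq_wordU, plaqWord_eq_wordU, val_wordU_eq, twists_smul]
  rfl

/-- The inverse word at the scaled field, twisted. [folklore] -/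
theorem val_inv_plaqWord_smul (U : Λ → 𝔸ˣ) (bd : Fin 4 → Λ × Bool) (A : Λ → 𝔸) (t : ℂ) :
    (((plaqWord U bd (t • A))⁻¹ : 𝔸ˣ) : 𝔸) =
      (((plaqWord U bd 0)⁻¹ : 𝔸ˣ) : 𝔸) * expProd ((twR U bd A).map (t • ·)) := by
  rw [plaqWord_eq_wordU, plaqWord_eq_wordU, val_inv_wordU_eq, twists_smul, reverse_map_neg_smul]
  rfl

/-- `plaqFunSym` at `A = 0` is the constant coefficient. [folklore] -/
theorem cubicPoly_zero (τ : 𝔸 →L[ℂ] ℂ) (U : Λ → 𝔸ˣ) (bd : Fin 4 → Λ × Bool) (A : Λ → 𝔸) :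
    cubicPoly τ U bd A 0 = plaqFunSym τ U bd 0 := by
  simp [cubicPoly]

/-- THE ALGEBRAIC IDENTITY behind the expansion: slice minus cubic polynomial = the two fourth-order word remainders,
paired with the background word. [folklore] -/
theorem slice_sub_cubicPoly (τ : 𝔸 →L[ℂ] ℂ) (U : Λ → 𝔸ˣ) (bd : Fin 4 → Λ × Bool) (A : Λ → 𝔸) (t : ℂ) :
    plaqFunSym τ U bd (t • A) - cubicPoly τ U bd A t =
      -((2 : ℂ)⁻¹ * (τ ((expProd ((tw U bd A).map (t • ·)) - 1 - polyL ((tw U bd A).map (t • ·))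
          - polyQ ((tw U bd A).map (t • ·)) - polyC ((tw U bd A).map (t • ·))) * (plaqWord U bd 0 : 𝔸))
        + τ ((((plaqWord U bd 0)⁻¹ : 𝔸ˣ) : 𝔸) * (expProd ((twR U bd A).map (t • ·)) - 1
          - polyL ((twR U bd A).map (t • ·)) - polyQ ((twR U bd A).map (t • ·)) - polyC ((twR U bd A).map (t • ·)))))) := by
  simp only [plaqFunSym, cubicPoly, a₁, a₂, a₃, coef, val_plaqWord_smul, val_inv_plaqWord_smul, polyL_smul, polyQ_smul,
    polyC_smul, sub_mul, mul_sub, smul_mul_assoc, mul_smul_comm, one_mul, mul_one, map_sub, map_smul, smul_eq_mul, expProd,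
    List.map_map, Function.comp_def]
  ring

end Slice


/-! ## §3b The remainder bound -/

section SliceBound

variable [Fintype Λ] [NormOneClass 𝔸] {U : Λ → 𝔸ˣ} (hU : ∀ b, ‖(U b : 𝔸)‖ ≤ 1)
  (hU' : ∀ b, ‖(((U b)⁻¹ : 𝔸ˣ) : 𝔸)‖ ≤ 1)
include hU hU'

/-- The background word is unit-bounded. [folklore] -/
theorem norm_plaqWord_zero_le (bd : Fin 4 → Λ × Bool) : ‖(plaqWord U bd (0 : Λ → 𝔸) : 𝔸)‖ ≤ 1 := by
  simpa using (expWord_plaqWord hU hU' bd).le 0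

/-- … and so is its inverse. [folklore] -/
theorem norm_inv_plaqWord_zero_le (bd : Fin 4 → Λ × Bool) : ‖(((plaqWord U bd (0 : Λ → 𝔸))⁻¹ : 𝔸ˣ) : 𝔸)‖ ≤ 1 := by
  simpa using (expWord_plaqWord hU hU' bd).le_inv 0

omit [Fintype Λ] in
/-- THE AMPLITUDE IS CONTROLLED BY THE FIELD ON THE FOUR BONDS: `S ≤ Σᵢ ‖A(bᵢ)‖`. [folklore] -/
theorem amp_le (bd : Fin 4 → Λ × Bool) (A : Λ → 𝔸) :
    amp U bd A ≤ ((List.ofFn bd).map fun bσ => ‖A bσ.1‖).sum :=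
  sum_norm_twists_le hU hU' A (List.ofFn bd) (U1 𝔸).one_mem

omit [Fintype Λ] in
/-- … hence by `4σ` when `‖A(bᵢ)‖ ≤ σ` on the boundary. [folklore] -/
theorem amp_le_four_mul (bd : Fin 4 → Λ × Bool) {A : Λ → 𝔸} {σ : ℝ} (hA : ∀ i, ‖A (bd i).1‖ ≤ σ) :
    amp U bd A ≤ 4 * σ := by
  refine (amp_le hU hU' bd A).trans ?_
  have h0 := hA 0; have h1 := hA 1; have h2 := hA 2; have h3 := hA 3
  simp [List.ofFn_succ, Fin.succ]
  linarith

omit [Fintype Λ] [NormOneClass 𝔸] hU hU' in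
/-- Nonnegativity of the amplitude. [folklore] -/
theorem amp_nonneg (bd : Fin 4 → Λ × Bool) (A : Λ → 𝔸) : 0 ≤ amp U bd A :=
  List.sum_nonneg (by
    intro x hx
    obtain ⟨y, _, rfl⟩ := List.mem_map.1 hx
    exact norm_nonneg _)

/-- **THE SLICE IS ITS CUBIC TAYLOR POLYNOMIAL UP TO `‖τ‖·ρ₄(|t|·S)`** ([Balaban1985Variational] (33)-TYPE quartic tail, at one
grid, for the symmetrised plaquette functional): `‖plaqFunSym(t•A) − (a₀ + a₁t + a₂t² + a₃t³)‖ ≤ ‖τ‖·ρ₄(‖t‖·S)`. [folklore] -/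
theorem norm_slice_sub_cubicPoly_le (τ : 𝔸 →L[ℂ] ℂ) (bd : Fin 4 → Λ × Bool) (A : Λ → 𝔸) (t : ℂ) :
    ‖plaqFunSym τ U bd (t • A) - cubicPoly τ U bd A t‖ ≤ ‖τ‖ * expRem4 (‖t‖ * amp U bd A) := by
  rw [slice_sub_cubicPoly]
  have hT := (t3_expProd_of_le (ys := (tw U bd A).map (t • ·)) (s := ‖t‖ * amp U bd A)
    (by rw [sum_norm_smul]; rfl)).ord3
  have hT' := (t3_expProd_of_le (ys := (twR U bd A).map (t • ·)) (s := ‖t‖ * amp U bd A)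
    (by rw [sum_norm_smul, twR, sum_norm_reverse_neg]; rfl)).ord3
  have h0 : 0 ≤ expRem4 (‖t‖ * amp U bd A) := expRem4_nonneg (mul_nonneg (norm_nonneg _) (amp_nonneg bd A))
  set R := expProd ((tw U bd A).map (t • ·)) - 1 - polyL ((tw U bd A).map (t • ·)) - polyQ ((tw U bd A).map (t • ·))
    - polyC ((tw U bd A).map (t • ·))
  set R' := expProd ((twR U bd A).map (t • ·)) - 1 - polyL ((twR U bd A).map (t • ·)) - polyQ ((twR U bd A).map (t • ·))
    - polyC ((twR U bd A).map (t • ·))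
  set W₀ := plaqWord U bd (0 : Λ → 𝔸)
  have h1 : ‖τ (R * (W₀ : 𝔸))‖ ≤ ‖τ‖ * expRem4 (‖t‖ * amp U bd A) := by
    refine (τ.le_opNorm _).trans (mul_le_mul_of_nonneg_left ?_ (norm_nonneg _))
    calc ‖R * (W₀ : 𝔸)‖ ≤ ‖R‖ * ‖(W₀ : 𝔸)‖ := norm_mul_le _ _
      _ ≤ expRem4 (‖t‖ * amp U bd A) * 1 :=
        mul_le_mul hT (norm_plaqWord_zero_le hU hU' bd) (norm_nonneg _) h0
      _ = _ := mul_one _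
  have h2 : ‖τ ((((W₀)⁻¹ : 𝔸ˣ) : 𝔸) * R')‖ ≤ ‖τ‖ * expRem4 (‖t‖ * amp U bd A) := by
    refine (τ.le_opNorm _).trans (mul_le_mul_of_nonneg_left ?_ (norm_nonneg _))
    calc ‖(((W₀)⁻¹ : 𝔸ˣ) : 𝔸) * R'‖ ≤ ‖(((W₀)⁻¹ : 𝔸ˣ) : 𝔸)‖ * ‖R'‖ := norm_mul_le _ _
      _ ≤ 1 * expRem4 (‖t‖ * amp U bd A) :=
        mul_le_mul (norm_inv_plaqWord_zero_le hU hU' bd) hT' (norm_nonneg _) zero_le_one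
      _ = _ := one_mul _
  rw [norm_neg, norm_mul, norm_inv, RCLike.norm_ofNat]
  calc 2⁻¹ * ‖τ (R * (W₀ : 𝔸)) + τ ((((W₀)⁻¹ : 𝔸ˣ) : 𝔸) * R')‖
      ≤ 2⁻¹ * (‖τ‖ * expRem4 (‖t‖ * amp U bd A) + ‖τ‖ * expRem4 (‖t‖ * amp U bd A)) := by
        gcongr
        exact (norm_add_le _ _).trans (add_le_add h1 h2)
    _ = ‖τ‖ * expRem4 (‖t‖ * amp U bd A) := by ring

end SliceBound


/-! ## §4 The derivatives of the slice at `0` and THE SPLIT of `ord₃` -/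

section Split

variable [Fintype Λ] [NormOneClass 𝔸] {U : Λ → 𝔸ˣ} (hU : ∀ b, ‖(U b : 𝔸)‖ ≤ 1)
  (hU' : ∀ b, ‖(((U b)⁻¹ : 𝔸ˣ) : 𝔸)‖ ≤ 1)

omit [Fintype Λ] [NormOneClass 𝔸] in
/-- The derivative of the cubic Taylor polynomial. [folklore] -/
theorem hasDerivAt_cubicPoly (τ : 𝔸 →L[ℂ] ℂ) (U : Λ → 𝔸ˣ) (bd : Fin 4 → Λ × Bool) (A : Λ → 𝔸) (t : ℂ) :
    HasDerivAt (cubicPoly τ U bd A)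
      (a₁ τ U bd A + 2 * t * a₂ τ U bd A + 3 * t ^ 2 * a₃ τ U bd A) t := by
  have h := ((((hasDerivAt_id t).mul_const (a₁ τ U bd A)).add ((hasDerivAt_pow 2 t).mul_const (a₂ τ U bd A))).add
    ((hasDerivAt_pow 3 t).mul_const (a₃ τ U bd A))).const_add (plaqFunSym τ U bd 0)
  refine (h.congr_of_eventuallyEq (Filter.Eventually.of_forall fun y => ?_)).congr_deriv ?_
  · simp only [cubicPoly, Pi.add_apply, id]
    ring
  · norm_num

omit [Fintype Λ] [NormOneClass 𝔸] in
/-- `P′(0) = a₁`. [folklore] -/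
theorem deriv_cubicPoly_zero (τ : 𝔸 →L[ℂ] ℂ) (U : Λ → 𝔸ˣ) (bd : Fin 4 → Λ × Bool) (A : Λ → 𝔸) :
    deriv (cubicPoly τ U bd A) 0 = a₁ τ U bd A := by
  rw [(hasDerivAt_cubicPoly τ U bd A 0).deriv]
  ring

omit [Fintype Λ] [NormOneClass 𝔸] in
/-- `P″(0) = 2a₂`. [folklore] -/
theorem deriv_deriv_cubicPoly_zero (τ : 𝔸 →L[ℂ] ℂ) (U : Λ → 𝔸ˣ) (bd : Fin 4 → Λ × Bool) (A : Λ → 𝔸) :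
    deriv (deriv (cubicPoly τ U bd A)) 0 = 2 * a₂ τ U bd A := by
  have hd : deriv (cubicPoly τ U bd A) = fun t => a₁ τ U bd A + 2 * t * a₂ τ U bd A + 3 * t ^ 2 * a₃ τ U bd A :=
    funext fun t => (hasDerivAt_cubicPoly τ U bd A t).deriv
  rw [hd]
  have h : HasDerivAt (fun t : ℂ => a₁ τ U bd A + 2 * t * a₂ τ U bd A + 3 * t ^ 2 * a₃ τ U bd A)
      (2 * a₂ τ U bd A) 0 := by
    have h2 := ((hasDerivAt_id (0 : ℂ)).const_mul (2 : ℂ)).mul_const (a₂ τ U bd A)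
    have h3 := ((hasDerivAt_pow 2 (0 : ℂ)).const_mul (3 : ℂ)).mul_const (a₃ τ U bd A)
    have h' := (h2.add h3).const_add (a₁ τ U bd A)
    refine (h'.congr_of_eventuallyEq (Filter.Eventually.of_forall fun y => ?_)).congr_deriv ?_
    · simp only [Pi.add_apply, id]
      ring
    · norm_num
  rw [h.deriv]

include hU hU'

/-- The slice remainder `h(t) = plaqFunSym(t•A) − P(t)` is an entire function … [folklore] -/
theorem differentiable_sliceRem (τ : 𝔸 →L[ℂ] ℂ) (bd : Fin 4 → Λ × Bool) (A : Λ → 𝔸) :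
    Differentiable ℂ (fun t : ℂ => plaqFunSym τ U bd (t • A) - cubicPoly τ U bd A t) := by
  have hg : Differentiable ℂ (fun t : ℂ => plaqFunSym τ U bd (t • A)) := by
    intro t
    have h1 : DifferentiableAt ℂ (plaqFunSym τ U bd) (t • A) := (analyticAt_plaqFunSym hU hU' τ bd _).differentiableAt
    have h2 : DifferentiableAt ℂ (fun s : ℂ => s • A) t := differentiableAt_id.smul_const A
    have h3 := h1.comp t h2
    simpa only [Function.comp_def] using h3
  exact hg.sub fun t => (hasDerivAt_cubicPoly τ U bd A t).differentiableAt

/-- … vanishing to FOURTH order at `0` (`‖h(t)‖ ≤ ‖τ‖(5∕96)S⁴·|t|⁴` for `|t|(S+1) < 1`). [folklore] -/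
theorem orderGe_four_sliceRem (τ : 𝔸 →L[ℂ] ℂ) (bd : Fin 4 → Λ × Bool) (A : Λ → 𝔸) :
    OrderGe (fun t : ℂ => plaqFunSym τ U bd (t • A) - cubicPoly τ U bd A t) 4 := by
  have hS := amp_nonneg (U := U) bd A
  have hr : 0 < 1 / (amp U bd A + 1) := by positivity
  refine OrderGe.of_bound_on_ball hr (C := ‖τ‖ * (5 / 96 * amp U bd A ^ 4)) fun t ht => ?_
  have ht' : ‖t‖ < 1 / (amp U bd A + 1) := mem_ball_zero_iff.1 ht
  have hle1 : ‖t‖ * amp U bd A ≤ 1 := by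
    have h1 : ‖t‖ * (amp U bd A + 1) ≤ 1 := by
      have := (lt_div_iff₀ (by positivity : (0 : ℝ) < amp U bd A + 1)).1 ht'
      exact this.le
    nlinarith [norm_nonneg t]
  calc ‖plaqFunSym τ U bd (t • A) - cubicPoly τ U bd A t‖ ≤ ‖τ‖ * expRem4 (‖t‖ * amp U bd A) :=
        norm_slice_sub_cubicPoly_le hU hU' τ bd A t
    _ ≤ ‖τ‖ * (5 / 96 * (‖t‖ * amp U bd A) ^ 4) :=
        mul_le_mul_of_nonneg_left (expRem4_le (by positivity) hle1) (norm_nonneg _)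
    _ = ‖τ‖ * (5 / 96 * amp U bd A ^ 4) * ‖t‖ ^ 4 := by ring

/-- … hence `h′(0) = 0` and `h″(0) = 0` (order-4 Schwarz lemma of `B11SchwarzRemainder` + the Taylor-coefficient
dictionary of `B13ExpansionOrder`). [folklore] -/
theorem deriv_sliceRem_zero (τ : 𝔸 →L[ℂ] ℂ) (bd : Fin 4 → Λ × Bool) (A : Λ → 𝔸) :
    deriv (fun t : ℂ => plaqFunSym τ U bd (t • A) - cubicPoly τ U bd A t) 0 = 0 ∧
      deriv (deriv (fun t : ℂ => plaqFunSym τ U bd (t • A) - cubicPoly τ U bd A t)) 0 = 0 := by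
  set h := fun t : ℂ => plaqFunSym τ U bd (t • A) - cubicPoly τ U bd A t with hh
  have hd : Differentiable ℂ h := differentiable_sliceRem hU hU' τ bd A
  have hdo : DifferentiableOn ℂ h (ball 0 1) := hd.differentiableOn
  -- a bound on the unit disc
  obtain ⟨M, hM⟩ : ∃ M, ∀ t ∈ ball (0 : ℂ) 1, ‖h t‖ ≤ M := by
    refine ⟨‖τ‖ * expRem4 (amp U bd A), fun t ht => ?_⟩
    have ht' : ‖t‖ ≤ 1 := (mem_ball_zero_iff.1 ht).le
    refine (norm_slice_sub_cubicPoly_le hU hU' τ bd A t).trans (mul_le_mul_of_nonneg_left ?_ (norm_nonneg _))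
    exact expRem4_mono (mul_nonneg (norm_nonneg _) (amp_nonneg bd A))
      (by nlinarith [amp_nonneg (U := U) bd A, norm_nonneg t])
  have hvan := (tail_vanish_and_bound one_pos 4 M h hdo hM (orderGe_four_sliceRem hU hU' τ bd A)).1
  have h1 : leadCoeff h 1 = 0 := hvan 1 (by norm_num)
  have h2 : leadCoeff h 2 = 0 := hvan 2 (by norm_num)
  have e1 := factorial_smul_leadCoeff one_pos hdo 1
  have e2 := factorial_smul_leadCoeff one_pos hdo 2
  rw [h1, smul_zero, iteratedDeriv_one] at e1
  rw [h2, smul_zero, iteratedDeriv_succ, iteratedDeriv_one] at e2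
  exact ⟨e1.symm, e2.symm⟩

/-- THE FIRST TWO TAYLOR COEFFICIENTS OF THE SLICE: `g′(0) = a₁`, `g″(0) = 2a₂` for `g(t) = plaqFunSym(t•A)`. [folklore] -/
theorem deriv_slice_plaqFunSym (τ : 𝔸 →L[ℂ] ℂ) (bd : Fin 4 → Λ × Bool) (A : Λ → 𝔸) :
    deriv (slice (plaqFunSym τ U bd) A) 0 = a₁ τ U bd A ∧
      deriv (deriv (slice (plaqFunSym τ U bd) A)) 0 = 2 * a₂ τ U bd A := by
  set h := fun t : ℂ => plaqFunSym τ U bd (t • A) - cubicPoly τ U bd A t with hh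
  have hd : Differentiable ℂ h := differentiable_sliceRem hU hU' τ bd A
  have hP : Differentiable ℂ (cubicPoly τ U bd A) := fun t => (hasDerivAt_cubicPoly τ U bd A t).differentiableAt
  have hg : slice (plaqFunSym τ U bd) A = fun t => h t + cubicPoly τ U bd A t := by
    funext t
    simp [hh, slice]
  obtain ⟨hz1, hz2⟩ := deriv_sliceRem_zero hU hU' τ bd A
  have hderiv : deriv (slice (plaqFunSym τ U bd) A) = fun t => deriv h t + deriv (cubicPoly τ U bd A) t := by
    funext t
    rw [hg]
    exact deriv_add (hd t) (hP t)
  refine ⟨?_, ?_⟩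
  · rw [hderiv]
    show deriv h 0 + deriv (cubicPoly τ U bd A) 0 = _
    rw [hz1, zero_add, deriv_cubicPoly_zero]
  · rw [hderiv]
    have hdh : DifferentiableAt ℂ (deriv h) 0 := ((hd.analyticAt 0).deriv).differentiableAt
    have hdP : DifferentiableAt ℂ (deriv (cubicPoly τ U bd A)) 0 := by
      have e : deriv (cubicPoly τ U bd A) =
          fun t => a₁ τ U bd A + 2 * t * a₂ τ U bd A + 3 * t ^ 2 * a₃ τ U bd A :=
        funext fun t => (hasDerivAt_cubicPoly τ U bd A t).deriv
      rw [e]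
      fun_prop
    rw [show (fun t => deriv h t + deriv (cubicPoly τ U bd A) t) = deriv h + deriv (cubicPoly τ U bd A) from rfl,
      deriv_add hdh hdP, hz2, zero_add, deriv_deriv_cubicPoly_zero]

/-- **`ord₃` OF THE SYMMETRISED PLAQUETTE FUNCTIONAL IS ITS CUBIC COEFFICIENT PLUS THE QUARTIC TAIL**:
`ord₃ (plaqFunSym τ U bd) A = a₃ + h(1)`, `h(1) = plaqFunSym A − P(1)`. [folklore] -/
theorem ord₃_plaqFunSym_eq (τ : 𝔸 →L[ℂ] ℂ) (bd : Fin 4 → Λ × Bool) (A : Λ → 𝔸) :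
    ord₃ (plaqFunSym τ U bd) A = a₃ τ U bd A + (plaqFunSym τ U bd A - cubicPoly τ U bd A 1) := by
  have han : AnalyticOnNhd ℂ (plaqFunSym τ U bd) (ball 0 (‖A‖ + 1)) := analyticOnNhd_plaqFunSym hU hU' τ bd _
  have hR : 0 < ‖A‖ + 1 := by positivity
  obtain ⟨hd1, hd2⟩ := deriv_slice_plaqFunSym hU hU' τ bd A
  have e1 : fderiv ℂ (plaqFunSym τ U bd) 0 A = a₁ τ U bd A := by
    rw [← deriv_slice_zero ((analyticAt_plaqFunSym hU hU' τ bd 0).differentiableAt) A, hd1]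
  have e2 : fderiv ℂ (fderiv ℂ (plaqFunSym τ U bd)) 0 A A = 2 * a₂ τ U bd A := by
    have hc : HasFDerivAt (fderiv ℂ (plaqFunSym τ U bd)) (fderiv ℂ (fderiv ℂ (plaqFunSym τ U bd)) 0) 0 :=
      ((han 0 (mem_ball_self hR)).fderiv.differentiableAt).hasFDerivAt
    have h := (hc.clm_apply (hasFDerivAt_const A (0 : Λ → 𝔸))).fderiv
    have e : fderiv ℂ (fun z => fderiv ℂ (plaqFunSym τ U bd) z A) 0 A = fderiv ℂ (fderiv ℂ (plaqFunSym τ U bd)) 0 A A := by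
      rw [h]
      simp
    rw [← e, ← deriv_deriv_slice_zero hR han A, hd2]
  rw [ord₃_apply, e1, e2]
  simp only [cubicPoly]
  ring

end Split


end Summit.QuantumFields.BalabanUV.T4Continuum.ShellMeasurePlaquetteCubicSlice

end
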